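import Summits.QuantumFields.YangMills.Theorems.BalabanLadderNTReferenceTransferCumulant
import Summits.QuantumFields.YangMills.Theorems.LangevinControlUVOSLegsFromFemtoAndGapStubLowerTwoPoint
import HarnessLib

/-!
# Crux `NT` (stmt-QuantumFields-19353): reference-state transfer, III — scales and lattice sums of the smearing
# bookkeeping (transfer cube, support box, depth of the support, restriction of box sums)

Helper file (`--supports stmt-QuantumFields-19353`) of the fleet lead prover of crux `NT` (unit `ym-spine-19353-p1`,
g4).  Pure bookkeeping for the composition «reference package ⇒ `LowerBounds`» of the crux idea
`Cruxes/NT/Ideas/reference-state-transfer.md` (its sorried `lowerBounds_of_refPackage`), shared by the two-point and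
the three-point halves (sibling files `…NTReferencePackageTwoPoint.lean`, `…ThreePoint.lean`):

* §1 box sums: `box_subset_box`, `sum_box_eq_sum_box` / `sum_box₂_eq` / `sum_box₃_eq` (a sum over a big box of a
  summand vanishing off a small box is the sum over the small box);
* §2 supports: a test function supported in the ball of radius `σ`, read at spacing `α` on the lattice, vanishes off
  the box of radius `⌈σ/α⌉₊` (`apply_smul_siteToE_eq_zero`, and `thetaTest_smul_siteToE_eq_zero` for its time
  reflection);
* §3 the transfer cube: at spacing `α = a β` the origin-centred cube `P_β` of lattice radius `R_P = ⌈(σ+κ)/α⌉₊ + 1`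
  carries every site of the support box at depth `≥ κ/α` (and `≥ 1`), has radius at most the reference radius
  `⌈ρ/α⌉₊` (nesting: `BoundaryLaw.cubeEdges_centred_subset`), is femto (`(2R_P+1) α ≤ ℓ`) and fits in every torus `2L+1` with `σ + κ + 1 ≤ α L`, as soon as
  `α ≤ 1/4`, `α ≤ (ρ−σ−κ)/2`, `α ≤ (ℓ − 2(σ+κ))/5` (`scales`); `eventually_le_of_tendsto` supplies such `β`.

Refs: card `Cruxes/NT/Ideas/reference-state-transfer.md` §Mechanism 3 and the docstring of its `lowerBounds_of_refPackage`.
-/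

set_option autoImplicit false

noncomputable section

open scoped SchwartzMap
open MeasureTheory Filter Topology
open Literature.MathematicalPhysics.QuantumFieldTheory Literature.MathematicalPhysics.QuantumLattice
open Literature.Probability.LatticeModels
open Summit.QuantumFields.YangMills.Cruxes.OSLegsFromFemtoAndGap.DlrCollarTransfer
open Summit.QuantumFields.YangMills.Cruxes.OSLegsFromFemtoAndGap.DlrCollarTransfer.StubLower
  (le_depth_cube abs_sub_le_norm_siteToE)

namespace Summit.QuantumFields.YangMills.Cruxes.NT.Reference

/-! ## §1 Box sums -/

/-- Boxes are monotone in the radius. [folklore] -/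
theorem box_subset_box {N M : ℕ} (h : N ≤ M) : box 4 N ⊆ box 4 M := by
  intro x hx
  rw [mem_box] at hx ⊢
  intro i
  have := hx i
  constructor <;> omega

/-- A sum over a box of a summand vanishing off a smaller box is the sum over the smaller box. [folklore] -/
theorem sum_box_eq_sum_box {N M : ℕ} (h : N ≤ M) (φ : (Fin 4 → ℤ) → ℝ)
    (hφ : ∀ x, x ∉ box 4 N → φ x = 0) : ∑ x ∈ box 4 M, φ x = ∑ x ∈ box 4 N, φ x :=
  (Finset.sum_subset (box_subset_box h) fun x _ hx => hφ x hx).symm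

/-- Double box sums of a summand vanishing off a smaller box in EACH variable. [folklore] -/
theorem sum_box₂_eq {N M : ℕ} (h : N ≤ M) (φ : (Fin 4 → ℤ) → (Fin 4 → ℤ) → ℝ)
    (h₁ : ∀ x, x ∉ box 4 N → ∀ y, φ x y = 0) (h₂ : ∀ y, y ∉ box 4 N → ∀ x, φ x y = 0) :
    ∑ x ∈ box 4 M, ∑ y ∈ box 4 M, φ x y = ∑ x ∈ box 4 N, ∑ y ∈ box 4 N, φ x y := by
  have inner : ∀ x, ∑ y ∈ box 4 M, φ x y = ∑ y ∈ box 4 N, φ x y := fun x =>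
    sum_box_eq_sum_box h (φ x) fun y hy => h₂ y hy x
  rw [sum_box_eq_sum_box h (fun x => ∑ y ∈ box 4 M, φ x y) fun x hx =>
    Finset.sum_eq_zero fun y _ => h₁ x hx y]
  exact Finset.sum_congr rfl fun x _ => inner x

/-- Triple box sums of a summand vanishing off a smaller box in EACH variable. [folklore] -/
theorem sum_box₃_eq {N M : ℕ} (h : N ≤ M) (φ : (Fin 4 → ℤ) → (Fin 4 → ℤ) → (Fin 4 → ℤ) → ℝ)
    (h₁ : ∀ x, x ∉ box 4 N → ∀ y z, φ x y z = 0) (h₂ : ∀ y, y ∉ box 4 N → ∀ x z, φ x y z = 0)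
    (h₃ : ∀ z, z ∉ box 4 N → ∀ x y, φ x y z = 0) :
    ∑ x ∈ box 4 M, ∑ y ∈ box 4 M, ∑ z ∈ box 4 M, φ x y z =
      ∑ x ∈ box 4 N, ∑ y ∈ box 4 N, ∑ z ∈ box 4 N, φ x y z := by
  have inner : ∀ x, ∑ y ∈ box 4 M, ∑ z ∈ box 4 M, φ x y z = ∑ y ∈ box 4 N, ∑ z ∈ box 4 N, φ x y z :=
    fun x => sum_box₂_eq h (φ x) (fun y hy z => h₂ y hy x z) (fun z hz y => h₃ z hz x y)
  rw [sum_box_eq_sum_box h (fun x => ∑ y ∈ box 4 M, ∑ z ∈ box 4 M, φ x y z) fun x hx =>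
    Finset.sum_eq_zero fun y _ => Finset.sum_eq_zero fun z _ => h₁ x hx y z]
  exact Finset.sum_congr rfl fun x _ => inner x

/-! ## §2 Supports read on the lattice -/

/-- A lattice site whose image at spacing `α > 0` lies in the ball of radius `σ` is in the box of radius
`⌈σ/α⌉₊`. [folklore] -/
theorem mem_box_of_norm_smul_le {α σ : ℝ} (hα : 0 < α) {x : Fin 4 → ℤ} (hx : ‖α • siteToE x‖ ≤ σ) :
    x ∈ box 4 ⌈σ / α⌉₊ := by
  rw [mem_box]
  intro j
  have h1 : |((x j : ℤ) : ℝ)| ≤ ‖siteToE x‖ := by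
    have := abs_sub_le_norm_siteToE 0 x j
    simpa using this
  have h2 : ‖siteToE x‖ ≤ σ / α := by
    rw [norm_smul, Real.norm_eq_abs, abs_of_pos hα] at hx
    rw [le_div_iff₀ hα]; linarith
  have h3 : |((x j : ℤ) : ℝ)| ≤ (⌈σ / α⌉₊ : ℝ) := (h1.trans h2).trans (Nat.le_ceil _)
  have h5 : |x j| ≤ ((⌈σ / α⌉₊ : ℕ) : ℤ) := by exact_mod_cast h3
  constructor <;> linarith [abs_le.1 h5 |>.1, abs_le.1 h5 |>.2]

/-- A test function supported in the ball of radius `σ`, read at spacing `α > 0`, vanishes off the box of radius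
`⌈σ/α⌉₊`. [folklore] -/
theorem apply_smul_siteToE_eq_zero {v : 𝓢(EuclideanSpace ℝ (Fin 4), ℝ)} {α σ : ℝ} (hα : 0 < α)
    (hv : tsupport (v : EuclideanSpace ℝ (Fin 4) → ℝ) ⊆ Metric.closedBall 0 σ) {x : Fin 4 → ℤ}
    (hx : x ∉ box 4 ⌈σ / α⌉₊) : v (α • siteToE x) = 0 := by
  by_contra h
  have hmem : α • siteToE x ∈ tsupport (v : EuclideanSpace ℝ (Fin 4) → ℝ) :=
    subset_tsupport _ (Function.mem_support.2 h)
  have hball := hv hmem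
  rw [mem_closedBall_zero_iff] at hball
  exact hx (mem_box_of_norm_smul_le hα hball)

/-- The time reflection of a test function supported in the ball of radius `σ`, read at spacing `α > 0`, vanishes
off the box of radius `⌈σ/α⌉₊` (the reflection is an isometry fixing the origin). [folklore] -/
theorem thetaTest_smul_siteToE_eq_zero {v : 𝓢(EuclideanSpace ℝ (Fin 4), ℝ)} {α σ : ℝ} (hα : 0 < α)
    (hv : tsupport (v : EuclideanSpace ℝ (Fin 4) → ℝ) ⊆ Metric.closedBall 0 σ) {x : Fin 4 → ℤ}
    (hx : x ∉ box 4 ⌈σ / α⌉₊) : thetaTest 4 v (α • siteToE x) = 0 := by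
  rw [thetaTest_apply]
  by_contra h
  have hmem : timeReflection 4 (α • siteToE x) ∈ tsupport (v : EuclideanSpace ℝ (Fin 4) → ℝ) :=
    subset_tsupport _ (Function.mem_support.2 h)
  have hball := hv hmem
  rw [mem_closedBall_zero_iff, LinearIsometryEquiv.norm_map] at hball
  exact hx (mem_box_of_norm_smul_le hα hball)

/-! ## §3 The transfer cube at spacing `α` -/

/-- Depth in the origin-centred cube `[-R, R]⁴` of a site with coordinates bounded by `t`: at least `R + 1 − t`.
[folklore] -/
theorem le_depth_origin (x : Fin 4 → ℤ) (R : ℕ) {t : ℝ} (hx : ∀ j, |((x j : ℤ) : ℝ)| ≤ t) :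
    (R : ℝ) + 1 - t ≤ (depth (fun _ => -(R : ℤ)) (2 * R + 1) x : ℝ) := by
  have h := le_depth_cube 0 x R (t := t) (fun j => by simpa using hx j)
  have e : (fun j => (0 : Fin 4 → ℤ) j - (R : ℤ)) = fun _ => -(R : ℤ) := by funext j; simp
  rw [e] at h
  exact h

/-- Sites of the box of radius `N` have coordinates bounded by `N`. [folklore] -/
theorem abs_cast_le_of_mem_box {N : ℕ} {x : Fin 4 → ℤ} (hx : x ∈ box 4 N) (j : Fin 4) :
    |((x j : ℤ) : ℝ)| ≤ (N : ℝ) := by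
  rw [mem_box] at hx
  have := hx j
  rw [abs_le]
  constructor <;> exact_mod_cast (by omega : _)

/-- **The scales of the transfer.**  At spacing `α > 0` with `α ≤ 1/4`, `2α ≤ ρ − σ − κ`, `5α ≤ ℓ − 2(σ+κ)`
(`σ, κ > 0`), the transfer cube of radius `R_P = ⌈(σ+κ)/α⌉₊ + 1`: (i) sits inside the reference cube of radius
`⌈ρ/α⌉₊`; (ii) is femto, `(2R_P+1) α ≤ ℓ`; (iii) fits in every torus of side `2L+1` with `σ + κ + 1 ≤ α L`
(`(2R_P+1) + 3 ≤ 2L+1`); (iv) the support box of radius `⌈σ/α⌉₊` lies in the box of radius `L` and (v) in the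
reference box; (vi) every site of the support box has depth `≥ κ/α` and `≥ 1` in the transfer cube. [folklore] -/
theorem scales {α σ κ ρ ℓ : ℝ} (hα : 0 < α) (hσ : 0 < σ) (hκ : 0 < κ) (h4 : α ≤ 1 / 4)
    (hρ : α ≤ (ρ - σ - κ) / 2) (hℓ : α ≤ (ℓ - 2 * (σ + κ)) / 5) {L : ℕ} (hL : σ + κ + 1 ≤ α * L)
    {RP : ℕ} (hRP : RP = ⌈(σ + κ) / α⌉₊ + 1) :
    RP ≤ ⌈ρ / α⌉₊ ∧ ((2 * RP + 1 : ℕ) : ℝ) * α ≤ ℓ ∧ 2 * RP + 1 + 3 ≤ 2 * L + 1 ∧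
    ⌈σ / α⌉₊ ≤ L ∧ ⌈σ / α⌉₊ ≤ ⌈ρ / α⌉₊ ∧
    ∀ x ∈ box 4 ⌈σ / α⌉₊, κ / α ≤ (depth (fun _ => -(RP : ℤ)) (2 * RP + 1) x : ℝ) ∧
      1 ≤ depth (fun _ => -(RP : ℤ)) (2 * RP + 1) x := by
  have hsk : 0 ≤ (σ + κ) / α := div_nonneg (by linarith) hα.le
  have c_lo : (σ + κ) / α ≤ (⌈(σ + κ) / α⌉₊ : ℝ) := Nat.le_ceil _
  have c_hi : (⌈(σ + κ) / α⌉₊ : ℝ) < (σ + κ) / α + 1 := Nat.ceil_lt_add_one hsk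
  have s_lo : σ / α ≤ (⌈σ / α⌉₊ : ℝ) := Nat.le_ceil _
  have s_hi : (⌈σ / α⌉₊ : ℝ) < σ / α + 1 := Nat.ceil_lt_add_one (div_nonneg hσ.le hα.le)
  have r_lo : ρ / α ≤ (⌈ρ / α⌉₊ : ℝ) := Nat.le_ceil _
  have hRPr : (RP : ℝ) = (⌈(σ + κ) / α⌉₊ : ℝ) + 1 := by rw [hRP]; push_cast; ring
  have hαinv : 4 ≤ 1 / α := by rw [le_div_iff₀ hα]; linarith [mul_le_mul_of_nonneg_left h4 (by norm_num : (0:ℝ) ≤ 4)]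
  -- (i) RP ≤ ⌈ρ/α⌉₊
  have h_i : (RP : ℝ) ≤ (⌈ρ / α⌉₊ : ℝ) := by
    have : (σ + κ) / α + 2 ≤ ρ / α := by
      rw [div_add' _ _ _ hα.ne', div_le_div_iff_of_pos_right hα]; linarith
    linarith
  refine ⟨by exact_mod_cast h_i, ?_, ?_, ?_, Nat.ceil_mono (div_le_div_of_nonneg_right (by linarith) hα.le), ?_⟩
  · -- (ii) femto
    have e : ((2 * RP + 1 : ℕ) : ℝ) = 2 * (RP : ℝ) + 1 := by push_cast; ring
    rw [e, hRPr]
    have : (2 * ((σ + κ) / α + 1 + 1) + 1) * α = 2 * (σ + κ) + 5 * α := by field_simp; ring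
    nlinarith [c_hi, hα]
  · -- (iii) torus
    have hLr : (σ + κ + 1) / α ≤ (L : ℝ) := by rw [div_le_iff₀ hα]; linarith
    have : (RP : ℝ) + 2 ≤ (L : ℝ) := by
      have e : (σ + κ + 1) / α = (σ + κ) / α + 1 / α := by rw [add_div]
      linarith
    have : RP + 2 ≤ L := by exact_mod_cast this
    omega
  · -- (iv) support box in the torus box
    have hLr : (σ + κ + 1) / α ≤ (L : ℝ) := by rw [div_le_iff₀ hα]; linarith
    have e : (σ + κ + 1) / α = σ / α + κ / α + 1 / α := by rw [add_div, add_div]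
    have hk : 0 ≤ κ / α := div_nonneg hκ.le hα.le
    have : (⌈σ / α⌉₊ : ℝ) ≤ (L : ℝ) := by linarith
    exact_mod_cast this
  · -- (vi) depth of the support box in the transfer cube
    intro x hx
    have hdepth := le_depth_origin x RP (abs_cast_le_of_mem_box hx)
    have hka : 0 < κ / α := div_pos hκ hα
    have hk1 : κ / α + 1 ≤ (depth (fun _ => -(RP : ℤ)) (2 * RP + 1) x : ℝ) := by
      have e : κ / α = (σ + κ) / α - σ / α := by rw [← sub_div]; ring_nf
      linarith
    refine ⟨by linarith, ?_⟩
    have h1 : (1 : ℝ) ≤ (depth (fun _ => -(RP : ℤ)) (2 * RP + 1) x : ℝ) := by linarith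
    exact_mod_cast h1

/-- From `a → 0`: eventually `a β ≤ δ` for any `δ > 0`. [folklore] -/
theorem eventually_le_of_tendsto {a : ℝ → ℝ} (ha : Tendsto a atTop (𝓝 0)) {δ : ℝ} (hδ : 0 < δ) :
    ∃ β₀ : ℝ, ∀ β, β₀ ≤ β → a β ≤ δ := by
  obtain ⟨β₀, h⟩ := Filter.eventually_atTop.1 (ha.eventually (Iic_mem_nhds hδ))
  exact ⟨β₀, fun β hβ => h β hβ⟩

/-- `1 / d⁴ ≤ (α/κ)⁴` for `d ≥ κ/α > 0`: the depth gain of the transfer collar. [folklore] -/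
theorem div_pow_depth_le {C κ α d : ℝ} (hC : 0 ≤ C) (hκ : 0 < κ) (hα : 0 < α) (hd : κ / α ≤ d) :
    C / d ^ 4 ≤ C * (α / κ) ^ 4 := by
  have hka : 0 < κ / α := div_pos hκ hα
  have hd0 : 0 < d := lt_of_lt_of_le hka hd
  rw [div_eq_mul_inv]
  refine mul_le_mul_of_nonneg_left ?_ hC
  rw [← inv_pow, show α / κ = (κ / α)⁻¹ by rw [inv_div]]
  exact pow_le_pow_left₀ (inv_nonneg.2 hd0.le) ((inv_le_inv₀ hd0 hka).2 hd) 4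

end Summit.QuantumFields.YangMills.Cruxes.NT.Reference

end
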